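import Summits.CriticalPhenomena.PercolationContinuityZ3.Theorems.PercNearOneGluingNoHeavyLowerTailSahiCTCC2LevelTwoVertex
import HarnessLib

/-!
# `NoHeavyLowerTail` (crux stmt-CriticalPhenomena-4575), P3 lane: THE ONE-VERTEX MONOTONICITY C2 HOLDS AT LEVEL `t = 2` —
# `coeff_{m+e_v} R_2 ≤ coeff_m R_2` whenever `m_v = 2`, for EVERY pair of up-sets and EVERY vertex; hence `R_2 ∈ ℕ[s]` through the C2 architecture

Support file (seat `prim-l12-p3`, gen 42; `--supports stmt-CriticalPhenomena-4575`).  Memo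
`run/shared/lean/prim/prim-l12/FROM-prim-l12-p3-g42-C2-LEVEL-TWO.md`.  Memo g27 §4 reduced `R_t(𝒳,𝒵) ∈ ℕ[s]` (all `t`) to the single conjecture C2
(`…SahiCTCLumpedVertex.coeff_Rlump_nonneg_of_C2`): for every vertex `v` and every profile `m` with `m_v = 2`, `coeff_{m+e_v} R_t ≤ coeff_m R_t`; g27 §4.2 wrote out
its `t = 2` instance `G_2` and left it unproved ("a direct proof of G_2 would be a second proof of RPrime and the template for G_3"); g41 proved its IDLE corner
(`…SahiCTCIdleCornerOne`).  THIS FILE proves C2 at `t = 2` completely (`coeff_Rt_two_C2`), from the three identities of `…SahiCTCC2LevelTwoVertex`: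
* generic vertex (`{v} ∉ 𝒳`, `{v} ∉ 𝒵`): `GF(delV D)·H¹ + H⁰ + (x'−x)(z'−z) − Π'·GF(common singletons ≠ v)` is `≥ 0` coefficientwise by the Kleitman-surplus
  argument of the idle corner run with TWO surpluses — `kap 𝒳 𝒵 ({v} ∪ dbl) sgl` for `H¹` and `kap 𝒳 𝒵 dbl sgl` for `H⁰` (`…C2LevelTwoPrep`), a common
  singleton inside the single set forcing `kap ≥ 1` (`one_le_kap_of_loop` at base `{v}` resp. `∅`) — `coeff_C2two_generic_nonneg`;
* loop of both: a generating function times `Π'`;  loop of one side: `…C2LevelTwoPrep.coeff_loopBlock_nonneg` (Kleitman twice); the other side by symmetry.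
Corollary `coeff_Rt_two_nonneg_of_C2two`: `R_2 ∈ ℕ[s]` re-derived through `coeff_Rlump_nonneg_of_C2` (a second proof of `…SahiCTCRPrime.coeff_Rprime_nonneg`).
Nothing is asserted about the crux; C2 for `t ≥ 3` is NOT proved here.
-/

noncomputable section

open scoped Classical

namespace Summit.CriticalPhenomena.PercolationContinuityZ3.Theorems.SahiCTCForms

open Finset MvPolynomial SahiCTCGenFun

variable {α : Type*} [DecidableEq α] [Fintype α]

/-! ### The generic vertex: the Kleitman-surplus argument with two surpluses -/

section Generic
variable {F G : Finset (Finset α)} {v : α}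

/-- **C2 at `t = 2`, generic vertex** (`{v} ∉ 𝒳`, `{v} ∉ 𝒵`): at every profile `m` the coefficient of
`GF(delV D)·H¹ + H⁰ + (x'−x)(z'−z) − Π'·GF(common small sets avoiding v)` is `≥ 0`.  `[s^m]` of it is
`Σ_{S : v ∉ S, #S ≤ 1, 1_S ≤ m} κ¹(m − 1_S) + κ⁰(m) + (≥ 0) − #{common singletons {i} ≠ v : m − e_i squarefree}` with `κ¹ = kap 𝒳 𝒵 ({v} ∪ dbl) sgl`,
`κ⁰ = kap 𝒳 𝒵 dbl sgl`; a common singleton inside the single set forces `κ ≥ 1` (`one_le_kap_of_loop` at base `{v}` resp. `∅`): either every subtracted unit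
is paid by the shifted `κ¹` at the same singleton, or `m` is squarefree with exactly one common singleton and `κ¹(m) + κ⁰(m) ≥ 2` pays. [this work] -/
theorem coeff_C2two_generic_nonneg (hF : IsUpperSet (F : Set (Finset α))) (hG : IsUpperSet (G : Set (Finset α)))
    (hvF : ({v} : Finset α) ∉ F) (hvG : ({v} : Finset α) ∉ G) (m : α →₀ ℕ) :
    0 ≤ (gf (delV v (bySize (· < 2) : Finset (Finset α)))
          * (gf (delV v (univ.powerset : Finset (Finset α))) * gf (linkV v F ∩ linkV v G) - gf (linkV v F) * gf (linkV v G))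
        + (gf (delV v (univ.powerset : Finset (Finset α))) * gf (delV v F ∩ delV v G) - gf (delV v F) * gf (delV v G))
        + (gf (linkV v F) - gf (delV v F)) * (gf (linkV v G) - gf (delV v G))
        - gf (delV v (univ.powerset : Finset (Finset α)))
          * gf ((delV v F ∩ delV v G).filter fun S => S ∈ (bySize (· < 2) : Finset (Finset α)))).coeff m := by
  set HL : MvPolynomial α ℤ := gf (delV v (univ.powerset : Finset (Finset α))) * gf (linkV v F ∩ linkV v G)
    - gf (linkV v F) * gf (linkV v G) with hHLdef
  set HD : MvPolynomial α ℤ := gf (delV v (univ.powerset : Finset (Finset α))) * gf (delV v F ∩ delV v G)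
    - gf (delV v F) * gf (delV v G) with hHDdef
  set Pi' : MvPolynomial α ℤ := gf (delV v (univ.powerset : Finset (Finset α))) with hPi'
  set Cs : Finset (Finset α) := (delV v F ∩ delV v G).filter fun S => S ∈ (bySize (· < 2) : Finset (Finset α)) with hCs
  have hF0 : (∅ : Finset α) ∉ F := fun h => hvF (hF (empty_subset _) h)
  have hG0 : (∅ : Finset α) ∉ G := fun h => hvG (hG (empty_subset _) h)
  have hHL : ∀ n, 0 ≤ HL.coeff n := coeff_harrisLink_nonneg hF hG
  have hHD : ∀ n, 0 ≤ HD.coeff n := coeff_harrisDel_nonneg hF hG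
  have hindv : ∀ M : Finset α, v ∉ M → ind M v = 0 := fun M hM => by rw [ind_apply, if_neg hM]
  -- K1 for the links (base `{v}`) and for the deletions (base `∅`)
  have hKL : ∀ M : Finset α, v ∉ M → ∀ j ∈ M, ({j} : Finset α) ∈ F → ({j} : Finset α) ∈ G → 1 ≤ HL.coeff (ind M) := by
    intro M hvM j hj hjF hjG
    rw [hHLdef, coeff_harrisLink_eq_kap F G (ind_apply_le_two M) (hindv M hvM), dbl_ind, sgl_ind, insert_empty]
    exact one_le_kap_of_loop hF hG hvF hvG hj (hF (singleton_subset_iff.2 (mem_insert_self j _)) hjF)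
      (hG (singleton_subset_iff.2 (mem_insert_self j _)) hjG)
  have hKD : ∀ M : Finset α, v ∉ M → ∀ j ∈ M, ({j} : Finset α) ∈ F → ({j} : Finset α) ∈ G → 1 ≤ HD.coeff (ind M) := by
    intro M hvM j hj hjF hjG
    rw [hHDdef, coeff_harrisDel_eq_kap F G (ind_apply_le_two M) (hindv M hvM), dbl_ind, sgl_ind]
    exact one_le_kap_of_loop hF hG hF0 hG0 hj (by rw [insert_empty]; exact hjF) (by rw [insert_empty]; exact hjG)
  -- members of `Cs` are common singletons `{i}`, `i ≠ v`
  have hCsmem : ∀ T ∈ Cs, ∃ i, T = {i} ∧ ({i} : Finset α) ∈ F ∧ ({i} : Finset α) ∈ G ∧ i ≠ v := by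
    intro T hT
    rw [hCs, mem_filter, mem_inter, mem_bySize_iff] at hT
    obtain ⟨⟨hTF, hTG⟩, hcard⟩ := hT
    obtain ⟨hTF', hvT⟩ := mem_filter.1 hTF
    have hTG' := (mem_filter.1 hTG).1
    have hne : T ≠ ∅ := fun h => hF0 (h ▸ hTF')
    have h1 : #T = 1 := by have := card_pos.2 (nonempty_iff_ne_empty.2 hne); omega
    obtain ⟨i, rfl⟩ := card_eq_one.1 h1
    exact ⟨i, rfl, hTF', hTG', fun h => hvT (h ▸ mem_singleton_self _)⟩
  -- expand the coefficient
  set F1 : Finset (Finset α) := (delV v (bySize (· < 2) : Finset (Finset α))).filter fun S => ind S ≤ m with hF1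
  set Yf : Finset (Finset α) := Cs.filter fun T => ind T ≤ m with hYf
  have hΔ : 0 ≤ ((gf (linkV v F) - gf (delV v F)) * (gf (linkV v G) - gf (delV v G))).coeff m :=
    coeff_mul_nonneg (coeff_gf_sub_gf_nonneg (delV_subset_linkV_of_isUpperSet hF))
      (coeff_gf_sub_gf_nonneg (delV_subset_linkV_of_isUpperSet hG)) m
  have hexp : (gf (delV v (bySize (· < 2) : Finset (Finset α))) * HL + HD
        + (gf (linkV v F) - gf (delV v F)) * (gf (linkV v G) - gf (delV v G)) - Pi' * gf Cs).coeff m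
      = ∑ S ∈ F1, HL.coeff (m - ind S) + HD.coeff m
        + ((gf (linkV v F) - gf (delV v F)) * (gf (linkV v G) - gf (delV v G))).coeff m
        - ∑ T ∈ Yf, Pi'.coeff (m - ind T) := by
    rw [coeff_sub, coeff_add, coeff_add, coeff_gf_mul, mul_comm Pi' (gf Cs), coeff_gf_mul]
  rw [hexp]
  -- keep from the Θ-sum only `S = ∅` and `S ∈ Yf`
  have hsub : insert ∅ Yf ⊆ F1 := by
    intro S hS
    rw [hF1, mem_filter]
    rcases mem_insert.1 hS with rfl | hS
    · refine ⟨mem_filter.2 ⟨(mem_bySize_iff _ _).2 (by simp), notMem_empty v⟩, ?_⟩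
      have : ind (∅ : Finset α) = 0 := by unfold ind; rw [sum_empty]
      rw [this]; exact bot_le
    · rw [hYf, mem_filter] at hS
      obtain ⟨i, rfl, -, -, hiv⟩ := hCsmem _ hS.1
      refine ⟨mem_filter.2 ⟨(mem_bySize_iff _ _).2 (by rw [card_singleton]; omega), ?_⟩, hS.2⟩
      rwa [mem_singleton, eq_comm]
  have hnot : (∅ : Finset α) ∉ Yf := by
    intro h
    obtain ⟨i, hi, -⟩ := hCsmem _ (mem_filter.1 h).1
    exact (singleton_ne_empty i) hi.symm
  have hind0 : ind (∅ : Finset α) = 0 := by unfold ind; rw [sum_empty]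
  have hF1ge : HL.coeff m + ∑ T ∈ Yf, HL.coeff (m - ind T) ≤ ∑ S ∈ F1, HL.coeff (m - ind S) := by
    have h1 : ∑ S ∈ insert ∅ Yf, HL.coeff (m - ind S) ≤ ∑ S ∈ F1, HL.coeff (m - ind S) :=
      sum_le_sum_of_subset_of_nonneg hsub fun S _ _ => hHL _
    rw [sum_insert hnot, hind0, tsub_zero] at h1
    exact h1
  suffices hcore : 0 ≤ HL.coeff m + HD.coeff m + ∑ T ∈ Yf, (HL.coeff (m - ind T) - Pi'.coeff (m - ind T)) by
    rw [sum_sub_distrib] at hcore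
    linarith
  by_cases hA : ∀ T ∈ Yf, Pi'.coeff (m - ind T) ≤ HL.coeff (m - ind T)
  · have h1 : 0 ≤ ∑ T ∈ Yf, (HL.coeff (m - ind T) - Pi'.coeff (m - ind T)) :=
      sum_nonneg fun T hT => sub_nonneg.2 (hA T hT)
    linarith [hHL m, hHD m]
  · simp only [not_forall, not_le, exists_prop] at hA
    obtain ⟨T₀, hT₀, hlt⟩ := hA
    have hT₀Cs : T₀ ∈ Cs := (mem_filter.1 hT₀).1
    have hle : ind T₀ ≤ m := (mem_filter.1 hT₀).2
    obtain ⟨i₀, rfl, hi₀F, hi₀G, hi₀v⟩ := hCsmem _ hT₀Cs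
    have hP1 : Pi'.coeff (m - ind {i₀}) ≤ 1 := coeff_gf_le_one _ _
    have hH0 : HL.coeff (m - ind {i₀}) = 0 := by have := hHL (m - ind {i₀}); linarith
    have hPpos : 0 < Pi'.coeff (m - ind {i₀}) := by linarith [hHL (m - ind {i₀})]
    obtain ⟨S₀, hS₀mem, hS₀⟩ := exists_mem_ind_eq_of_coeff_gf_pos hPpos
    have hvS₀ : v ∉ S₀ := not_mem_of_mem_delV hS₀mem
    -- no common singleton lies in `S₀`
    have hnoS₀ : ∀ j ∈ S₀, ¬ (({j} : Finset α) ∈ F ∧ ({j} : Finset α) ∈ G) := by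
      intro j hj hjFG
      have h := hKL S₀ hvS₀ j hj hjFG.1 hjFG.2
      rw [hS₀, hH0] at h
      exact absurd h (by norm_num)
    have hi₀S₀ : i₀ ∉ S₀ := fun h => hnoS₀ i₀ h ⟨hi₀F, hi₀G⟩
    have hmeq : m = ind (insert i₀ S₀) := by
      have hsing : ind ({i₀} : Finset α) = Finsupp.single i₀ 1 := by unfold ind; rw [sum_singleton]
      rw [ind_insert hi₀S₀, ← hsing, hS₀, add_comm, tsub_add_cancel_of_le hle]
    have hvM : v ∉ insert i₀ S₀ := by
      rw [mem_insert, not_or]; exact ⟨fun h => hi₀v h.symm, hvS₀⟩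
    have hm1 : 1 ≤ HL.coeff m := by rw [hmeq]; exact hKL _ hvM i₀ (mem_insert_self _ _) hi₀F hi₀G
    have hm0 : 1 ≤ HD.coeff m := by rw [hmeq]; exact hKD _ hvM i₀ (mem_insert_self _ _) hi₀F hi₀G
    -- `Yf = {{i₀}}`
    have hYfeq : Yf = {{i₀}} := by
      refine eq_singleton_iff_unique_mem.2 ⟨hT₀, fun T hT => ?_⟩
      obtain ⟨i, rfl, hiF, hiG, -⟩ := hCsmem _ (mem_filter.1 hT).1
      have hTle : ind ({i} : Finset α) ≤ m := (mem_filter.1 hT).2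
      rw [hmeq, ind_le_ind_iff, singleton_subset_iff, mem_insert] at hTle
      rcases hTle with rfl | hi
      · rfl
      · exact absurd ⟨hiF, hiG⟩ (hnoS₀ i hi)
    rw [hYfeq, sum_singleton]
    linarith

end Generic

/-! ### Assembly: C2 at `t = 2`, and `R_2 ∈ ℕ[s]` through the C2 architecture -/

section Assembly
variable {F G : Finset (Finset α)}

/-- The C2 difference `P₂ − P₃` of `R_2` at any vertex has nonnegative coefficients. [this work] -/
theorem coeff_RlumpVx_two_sub_three_nonneg (hF : IsUpperSet (F : Set (Finset α))) (hG : IsUpperSet (G : Set (Finset α)))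
    (v : α) (m : α →₀ ℕ) :
    0 ≤ (RlumpVx (bySize (· < 2)) F G v 2 - RlumpVx (bySize (· < 2)) F G v 3).coeff m := by
  by_cases hvF : ({v} : Finset α) ∈ F <;> by_cases hvG : ({v} : Finset α) ∈ G
  · rw [RlumpVx_two_sub_three_loops hF hG hvF hvG]
    exact coeff_mul_nonneg (coeff_gf_nonneg _) (coeff_gf_nonneg _) m
  · rw [RlumpVx_two_sub_three_loop hF hvF hvG]
    refine coeff_loopBlock_nonneg hF hG (fun S hS => (mem_filter.1 (mem_filter.1 hS).1).1)
      (fun S hS => (mem_filter.1 hS).2) m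
  · rw [RlumpVx_two_sub_three_comm, RlumpVx_two_sub_three_loop hG hvG hvF]
    refine coeff_loopBlock_nonneg hG hF (fun S hS => (mem_filter.1 (mem_filter.1 hS).1).1)
      (fun S hS => (mem_filter.1 hS).2) m
  · rw [RlumpVx_two_sub_three_generic hvF hvG]
    exact coeff_C2two_generic_nonneg hF hG hvF hvG m

/-- **C2 HOLDS AT LEVEL `t = 2`** (memo g27 §4.2 `G_2 ∈ ℕ[s]`): for all up-sets `𝒳, 𝒵`, every vertex `v` and every profile `m` with `m_v = 2`,
`coeff_{m + e_v} R_2(𝒳,𝒵) ≤ coeff_m R_2(𝒳,𝒵)`. [this work] -/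
theorem coeff_Rt_two_C2 (hF : IsUpperSet (F : Set (Finset α))) (hG : IsUpperSet (G : Set (Finset α)))
    (m : α →₀ ℕ) (v : α) (hv : m v = 2) :
    (Rt 2 F G).coeff (m + Finsupp.single v 1) ≤ (Rt 2 F G).coeff m := by
  set m₀ := m - Finsupp.single v 2 with hm₀
  have hm₀v : m₀ v = 0 := by rw [hm₀, Finsupp.tsub_apply, Finsupp.single_eq_same, hv]
  have hm_eq : m = m₀ + Finsupp.single v 2 := by
    rw [hm₀, tsub_add_cancel_of_le]
    rw [Finsupp.single_le_iff, hv]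
  have h3 : m + Finsupp.single v 1 = m₀ + Finsupp.single v 3 := by
    rw [hm_eq, add_assoc, ← Finsupp.single_add]
  rw [h3, hm_eq, Rt_eq_Rlump, coeff_Rlump_add_single _ F G v hm₀v (by norm_num),
    coeff_Rlump_add_single _ F G v hm₀v (by norm_num), ← sub_nonneg, ← coeff_sub]
  exact coeff_RlumpVx_two_sub_three_nonneg hF hG v m₀

omit [DecidableEq α] in
/-- The threshold family `{S : #S < t}` is a down-set. [this work] -/
theorem isLowerSet_bySize_lt (t : ℕ) : IsLowerSet ((bySize (· < t) : Finset (Finset α)) : Set (Finset α)) := by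
  intro S T hTS hS
  rw [Finset.mem_coe, mem_bySize_iff] at hS ⊢
  exact lt_of_le_of_lt (card_le_card hTS) hS

/-- **`R_2 ∈ ℕ[s]` through the C2 architecture** (a second proof of `…SahiCTCRPrime.coeff_Rprime_nonneg` / `…SahiCTCRtForm.coeff_Rt_two_nonneg`):
C2 at `t = 2` (this file) fed into `…SahiCTCLumpedVertex.coeff_Rlump_nonneg_of_C2`. [this work] -/
theorem coeff_Rt_two_nonneg_of_C2two (hF : IsUpperSet (F : Set (Finset α))) (hG : IsUpperSet (G : Set (Finset α))) (m : α →₀ ℕ) :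
    0 ≤ (Rt 2 F G).coeff m := by
  rw [Rt_eq_Rlump]
  refine coeff_Rlump_nonneg_of_C2 (isLowerSet_bySize_lt 2) hF hG (fun m v hv => ?_) m
  rw [← Rt_eq_Rlump]
  exact coeff_Rt_two_C2 hF hG m v hv

end Assembly

end Summit.CriticalPhenomena.PercolationContinuityZ3.Theorems.SahiCTCForms
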